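import Mathlib.Algebra.QuadraticAlgebra.Basic
import Mathlib.NumberTheory.NumberField.Basic
import Mathlib.FieldTheory.Galois.Basic
import Mathlib.Tactic.NormNum.IsSquare
import HarnessLib

/-!
# The field `F₄ = ℚ(√-1, √41, √73)` of Dokchitser–Dokchitser (2011), proof of Theorem 2

T. Dokchitser–V. Dokchitser, *A note on the Mordell–Weil rank modulo `n`*, J. Number Theory 131
(2011) 1833–1839 (arXiv:0910.4588), prove Theorem 2 ("for `n ∈ {3,4,5}` the Mordell–Weil rank
modulo `n` is not a sum of local invariants") for `n = 4` with the field
`F₄ = ℚ(√-1, √41, √73)`: "`F₄` [satisfies] the assumptions of Lemma 3 with `n = 4`" (the number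
of places of `F₄` above each place of `ℚ` is a multiple of `4`) and "2-descent shows that
`rk E/F₄ = 6`" for `E = 480a1`. The tree vendors this as the named fact
`Literature.Barriers.BirchSwinnertonDyer.DokchitserDokchitser2011_rank_480a1_F4`
(`RankNotSumOfLocalInvariantsProofs.lean`), an existential over a number field `F` of degree `8`,
Galois over `ℚ`, containing `√-1, √41, √73`, with the splitting property and `rk E(F) = 6`.

This file builds a CONCRETE MODEL of `F₄` and proves its field theory, so that the named fact
reduces to its only non-formalisable input, the Magma rank computation (see
`RankNotSumOfLocalInvariantsF4Places.lean` for the places and the reduction):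

* `DokchitserDokchitser2011.K1 = ℚ(√-1)`, `K2 = K1(√41)`, `F4 = K2(√73)`, a tower of Mathlib
  `QuadraticAlgebra`s; each step is a field because `-1`, `41`, `73` are not squares in `ℚ`,
  `K1`, `K2` respectively (`K1.sq_ne_41`, `K2.sq_ne_73`, by comparing coordinates);
* `F4` is a number field of degree `8` (`F4.finrank_eq`) generated by `rtm1 = √-1`,
  `rt41 = √41`, `rt73 = √73` (`F4.adjoin_eq_top`);
* every `σ ∈ Aut(F4/ℚ)` maps each of the three square roots to `±` itself and is determined by
  these signs (`F4.algEquiv_eq_of_apply_eq`); in particular `σ² = 1` (`F4.algEquiv_mul_self`);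
* `F4` is the splitting field of the separable polynomial `(X² + 1)(X² - 41)(X² - 73)`
  (`F4.isSplittingField`), hence Galois over `ℚ` (`F4.isGalois`) with `|Gal(F4/ℚ)| = 8`.

Design notes. The two `Algebra ℚ F4` instances (Mathlib's `DivisionRing.toRatAlgebra` and
`QuadraticAlgebra.instAlgebra`) agree definitionally (`rfl`); statements below use rational
casts `(q : F4)` and `map_ratCast` so as not to depend on the choice. Everything here is
elementary and [folklore]; only the choice of field is from the source.

## References

* T. Dokchitser, V. Dokchitser, *A note on the Mordell–Weil rank modulo `n`*, J. Number Theory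
  131 (2011) 1833–1839, arXiv:0910.4588, proof of Thm. 2 (p. 3 of the arXiv version).
  [DokchitserDokchitser2011RankModN]
-/

noncomputable section

open QuadraticAlgebra

namespace Literature.Barriers.BirchSwinnertonDyer

namespace DokchitserDokchitser2011

/-- A rational number whose square is `q` forces `q` to be a square. [folklore] -/
theorem rat_mul_self_ne {q : ℚ} (hq : ¬ IsSquare q) (x : ℚ) : x * x ≠ q := fun h =>
  hq ⟨x, h.symm⟩

/-- The Gaussian field `ℚ(√-1)`, as the quadratic algebra `ℚ[ω]/(ω² + 1)`. [folklore] -/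
abbrev K1 : Type := QuadraticAlgebra ℚ (-1) 0

/-- `-1` is not a square in `ℚ`, so `K1 = ℚ(√-1)` is a field. [folklore] -/
instance K1.instFact : Fact (∀ r : ℚ, r ^ 2 ≠ (-1 : ℚ) + 0 * r) :=
  ⟨fun r h => by nlinarith [sq_nonneg r]⟩

/-- Coordinates of a rational number in `K1`. [folklore] -/
@[simp] theorem K1.ratCast_re (q : ℚ) : (q : K1).re = q := rfl
/-- Coordinates of a rational number in `K1`. [folklore] -/
@[simp] theorem K1.ratCast_im (q : ℚ) : (q : K1).im = 0 := rfl

/-- In `ℚ(√-1)`: if `u² = q ∈ ℚ` then `q` or `-q` is a rational square. [folklore] -/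
theorem K1.exists_of_mul_self_eq {u : K1} {q : ℚ} (h : u * u = (q : K1)) :
    ∃ x : ℚ, x * x = q ∨ -(x * x) = q := by
  have h1 := congrArg QuadraticAlgebra.re h
  have h2 := congrArg QuadraticAlgebra.im h
  simp only [re_mul, im_mul, K1.ratCast_re, K1.ratCast_im] at h1 h2
  have h3 : u.re * u.im = 0 := by linear_combination h2 / 2
  rcases mul_eq_zero.mp h3 with h0 | h0
  · exact ⟨u.im, Or.inr (by rw [h0] at h1; linear_combination h1)⟩
  · exact ⟨u.re, Or.inl (by rw [h0] at h1; linear_combination h1)⟩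

/-- `41` is not a square in `ℚ(√-1)`. [folklore] -/
theorem K1.sq_ne_41 (r : K1) : r ^ 2 ≠ (41 : K1) + 0 * r := by
  intro h
  rw [zero_mul, add_zero, sq] at h
  obtain ⟨x, hx | hx⟩ := K1.exists_of_mul_self_eq (q := 41) (by simpa using h)
  · exact rat_mul_self_ne (by norm_num) x hx
  · nlinarith [mul_self_nonneg x]

/-- The biquadratic field `ℚ(√-1, √41)`, as `K1[ω]/(ω² - 41)`. [folklore] -/
abbrev K2 : Type := QuadraticAlgebra K1 41 0

/-- `41` is not a square in `ℚ(√-1)`, so `K2 = ℚ(√-1, √41)` is a field. [folklore] -/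
instance K2.instFact : Fact (∀ r : K1, r ^ 2 ≠ (41 : K1) + 0 * r) := ⟨K1.sq_ne_41⟩

/-- Coordinates of a rational number in `K2`. [folklore] -/
@[simp] theorem K2.ratCast_re (q : ℚ) : (q : K2).re = q := rfl
/-- Coordinates of a rational number in `K2`. [folklore] -/
@[simp] theorem K2.ratCast_im (q : ℚ) : (q : K2).im = 0 := rfl
/-- Coordinates of an element of `K1` in `K2`. [folklore] -/
@[simp] theorem K2.algebraMap_K1_re (t : K1) : (algebraMap K1 K2 t).re = t := rfl
/-- Coordinates of an element of `K1` in `K2`. [folklore] -/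
@[simp] theorem K2.algebraMap_K1_im (t : K1) : (algebraMap K1 K2 t).im = 0 := rfl

/-- `73` is not a square in `ℚ(√-1, √41)`. [folklore] -/
theorem K2.sq_ne_73 (r : K2) : r ^ 2 ≠ (73 : K2) + 0 * r := by
  intro h
  rw [zero_mul, add_zero, sq] at h
  have h1 := congrArg QuadraticAlgebra.re h
  have h2 := congrArg QuadraticAlgebra.im h
  simp only [re_mul, im_mul, re_ofNat, im_ofNat] at h1 h2
  have h3 : r.re * r.im = 0 := by linear_combination h2 / 2
  rcases mul_eq_zero.mp h3 with h0 | h0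
  · -- `r.re = 0`: `41 v² = 73`, so `(41 v)² = 2993`
    rw [h0] at h1
    have h4 : ((41 : K1) * r.im) * ((41 : K1) * r.im) = ((2993 : ℚ) : K1) := by
      have e : ((2993 : ℚ) : K1) = 41 * 73 := by norm_num
      rw [e]
      linear_combination (41 : K1) * h1
    obtain ⟨x, hx | hx⟩ := K1.exists_of_mul_self_eq h4
    · exact rat_mul_self_ne (by norm_num) x hx
    · nlinarith [mul_self_nonneg x]
  · -- `r.im = 0`: `u² = 73`
    rw [h0] at h1
    have h4 : r.re * r.re = ((73 : ℚ) : K1) := by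
      rw [Rat.cast_ofNat]
      linear_combination h1
    obtain ⟨x, hx | hx⟩ := K1.exists_of_mul_self_eq h4
    · exact rat_mul_self_ne (by norm_num) x hx
    · nlinarith [mul_self_nonneg x]

/-- The triquadratic field `F₄ = ℚ(√-1, √41, √73)` of the proof of Theorem 2 of
Dokchitser–Dokchitser (2011), as `K2[ω]/(ω² - 73)`. [cite: DokchitserDokchitser2011RankModN, proof of Thm. 2] -/
abbrev F4 : Type := QuadraticAlgebra K2 73 0

/-- `73` is not a square in `ℚ(√-1, √41)`, so `F4` is a field. [folklore] -/
instance F4.instFact : Fact (∀ r : K2, r ^ 2 ≠ (73 : K2) + 0 * r) := ⟨K2.sq_ne_73⟩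

/-- Coordinates of a rational number in `F4`. [folklore] -/
@[simp] theorem F4.ratCast_re (q : ℚ) : (q : F4).re = q := rfl
/-- Coordinates of a rational number in `F4`. [folklore] -/
@[simp] theorem F4.ratCast_im (q : ℚ) : (q : F4).im = 0 := rfl
/-- Coordinates of an element of `K2` in `F4`. [folklore] -/
@[simp] theorem F4.algebraMap_K2_re (u : K2) : (algebraMap K2 F4 u).re = u := rfl
/-- Coordinates of an element of `K2` in `F4`. [folklore] -/
@[simp] theorem F4.algebraMap_K2_im (u : K2) : (algebraMap K2 F4 u).im = 0 := rfl
/-- Coordinates of an element of `K1` in `F4`. [folklore] -/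
@[simp] theorem F4.algebraMap_K1_re (t : K1) : (algebraMap K1 F4 t).re = algebraMap K1 K2 t := rfl
/-- Coordinates of an element of `K1` in `F4`. [folklore] -/
@[simp] theorem F4.algebraMap_K1_im (t : K1) : (algebraMap K1 F4 t).im = 0 := rfl

/-- `K2` is finite over `ℚ` (degree `4`). [folklore] -/
instance K2.instModuleFinite : Module.Finite ℚ K2 := Module.Finite.trans K1 K2

/-- `F4` is finite over `ℚ` (degree `8`). [folklore] -/
instance F4.instModuleFinite : Module.Finite ℚ F4 := Module.Finite.trans K2 F4

/-- `F4` is a number field. [folklore] -/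
instance F4.instNumberField : NumberField F4 := NumberField.mk

/-- `[F4 : ℚ] = 8`. [folklore] -/
theorem F4.finrank_eq : Module.finrank ℚ F4 = 8 := by
  rw [← Module.finrank_mul_finrank ℚ K2 F4, ← Module.finrank_mul_finrank ℚ K1 K2,
    finrank_eq_two, finrank_eq_two, finrank_eq_two]

/-- `√-1 ∈ F4`. [folklore] -/
def F4.rtm1 : F4 := algebraMap K1 F4 ω
/-- `√41 ∈ F4`. [folklore] -/
def F4.rt41 : F4 := algebraMap K2 F4 ω
/-- `√73 ∈ F4`. [folklore] -/
def F4.rt73 : F4 := ω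

/-- `(√-1)² = -1` in `F4`. [folklore] -/
@[simp] theorem F4.rtm1_mul_self : F4.rtm1 * F4.rtm1 = -1 := by
  rw [F4.rtm1, ← map_mul, omega_mul_omega_eq_mk]
  ext <;> simp

/-- `(√41)² = 41` in `F4`. [folklore] -/
@[simp] theorem F4.rt41_mul_self : F4.rt41 * F4.rt41 = 41 := by
  rw [F4.rt41, ← map_mul, omega_mul_omega_eq_mk]
  ext <;> simp

/-- `(√73)² = 73` in `F4`. [folklore] -/
@[simp] theorem F4.rt73_mul_self : F4.rt73 * F4.rt73 = 73 := by
  rw [F4.rt73, omega_mul_omega_eq_mk]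
  ext <;> simp

/-- Coordinates: every `t ∈ K1` is `t.re + t.im · √-1` inside `F4`. [folklore] -/
theorem F4.algebraMap_K1 (t : K1) :
    algebraMap K1 F4 t = (t.re : F4) + (t.im : F4) * F4.rtm1 := by
  rw [F4.rtm1]
  ext <;> simp

/-- Coordinates: every `u ∈ K2` is `u.re + u.im · √41` inside `F4`. [folklore] -/
theorem F4.algebraMap_K2 (u : K2) :
    algebraMap K2 F4 u = algebraMap K1 F4 u.re + algebraMap K1 F4 u.im * F4.rt41 := by
  rw [F4.rt41]
  ext <;> simp

/-- Coordinates: every `z ∈ F4` is `z.re + z.im · √73`. [folklore] -/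
theorem F4.self_eq (z : F4) : z = algebraMap K2 F4 z.re + algebraMap K2 F4 z.im * F4.rt73 := by
  rw [F4.rt73]
  ext <;> simp

/-- An automorphism of `F4` fixing `√-1`, `√41`, `√73` is the identity. [folklore] -/
theorem F4.algEquiv_eq_one {σ : F4 ≃ₐ[ℚ] F4} (ha : σ F4.rtm1 = F4.rtm1) (hb : σ F4.rt41 = F4.rt41)
    (hc : σ F4.rt73 = F4.rt73) : σ = 1 := by
  have h1 : ∀ t : K1, σ (algebraMap K1 F4 t) = algebraMap K1 F4 t := fun t => by
    rw [F4.algebraMap_K1, map_add, map_mul, ha, map_ratCast, map_ratCast]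
  have h2 : ∀ u : K2, σ (algebraMap K2 F4 u) = algebraMap K2 F4 u := fun u => by
    rw [F4.algebraMap_K2, map_add, map_mul, hb, h1, h1]
  refine AlgEquiv.ext fun z => ?_
  rw [AlgEquiv.one_apply, F4.self_eq z, map_add, map_mul, hc, h2, h2]

/-- A square root of a rational number is mapped to `±` itself by any automorphism. [folklore] -/
theorem F4.algEquiv_apply_eq_or (σ : F4 ≃ₐ[ℚ] F4) {x : F4} {q : ℚ}
    (hx : x * x = (q : F4)) : σ x = x ∨ σ x = -x := by
  have h : (σ x - x) * (σ x + x) = 0 := by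
    have h2 : σ x * σ x = x * x := by rw [← map_mul, hx, map_ratCast]
    linear_combination h2
  rcases mul_eq_zero.mp h with h0 | h0
  · exact Or.inl (sub_eq_zero.mp h0)
  · exact Or.inr (eq_neg_of_add_eq_zero_left h0)

/-- `σ(√-1) = ±√-1`. [folklore] -/
theorem F4.algEquiv_rtm1 (σ : F4 ≃ₐ[ℚ] F4) : σ F4.rtm1 = F4.rtm1 ∨ σ F4.rtm1 = -F4.rtm1 :=
  F4.algEquiv_apply_eq_or σ (q := -1) (by simp)
/-- `σ(√41) = ±√41`. [folklore] -/
theorem F4.algEquiv_rt41 (σ : F4 ≃ₐ[ℚ] F4) : σ F4.rt41 = F4.rt41 ∨ σ F4.rt41 = -F4.rt41 :=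
  F4.algEquiv_apply_eq_or σ (q := 41) (by simp)
/-- `σ(√73) = ±√73`. [folklore] -/
theorem F4.algEquiv_rt73 (σ : F4 ≃ₐ[ℚ] F4) : σ F4.rt73 = F4.rt73 ∨ σ F4.rt73 = -F4.rt73 :=
  F4.algEquiv_apply_eq_or σ (q := 73) (by simp)

/-- `Gal(F4/ℚ)` has exponent `2`: every automorphism is an involution. [folklore] -/
theorem F4.algEquiv_mul_self (σ : F4 ≃ₐ[ℚ] F4) : σ * σ = 1 := by
  apply F4.algEquiv_eq_one
  · rcases F4.algEquiv_rtm1 σ with h | h <;> simp [AlgEquiv.mul_apply, h]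
  · rcases F4.algEquiv_rt41 σ with h | h <;> simp [AlgEquiv.mul_apply, h]
  · rcases F4.algEquiv_rt73 σ with h | h <;> simp [AlgEquiv.mul_apply, h]

/-- Two automorphisms with the same values on `√-1, √41, √73` are equal. [folklore] -/
theorem F4.algEquiv_eq_of_apply_eq {σ τ : F4 ≃ₐ[ℚ] F4} (ha : σ F4.rtm1 = τ F4.rtm1)
    (hb : σ F4.rt41 = τ F4.rt41) (hc : σ F4.rt73 = τ F4.rt73) : σ = τ := by
  have hστ : σ * τ = 1 := by
    apply F4.algEquiv_eq_one
    · rcases F4.algEquiv_rtm1 τ with h | h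
      · rw [AlgEquiv.mul_apply, h, ha, h]
      · rw [AlgEquiv.mul_apply, h, map_neg, ha, h, neg_neg]
    · rcases F4.algEquiv_rt41 τ with h | h
      · rw [AlgEquiv.mul_apply, h, hb, h]
      · rw [AlgEquiv.mul_apply, h, map_neg, hb, h, neg_neg]
    · rcases F4.algEquiv_rt73 τ with h | h
      · rw [AlgEquiv.mul_apply, h, hc, h]
      · rw [AlgEquiv.mul_apply, h, map_neg, hc, h, neg_neg]
  calc σ = σ * (τ * τ) := by rw [F4.algEquiv_mul_self, mul_one]
    _ = τ := by rw [← mul_assoc, hστ, one_mul]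

/-! ### `F4/ℚ` is Galois: it is the splitting field of `(X² + 1)(X² - 41)(X² - 73)` -/

open Polynomial

/-- The polynomial `(X² + 1)(X² - 41)(X² - 73) ∈ ℚ[X]`. [folklore] -/
def F4.poly : ℚ[X] := (X ^ 2 - C (-1)) * (X ^ 2 - C 41) * (X ^ 2 - C 73)

/-- `X² - c = (X - r)(X + r)` when `r² = c`, so it splits. [folklore] -/
theorem splits_X_sq_sub_C {R : Type*} [CommRing R] {r c : R} (h : r * r = c) :
    Splits (X ^ 2 - C c : R[X]) := by
  have e : (X ^ 2 - C c : R[X]) = (X - C r) * (X + C r) := by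
    rw [← h, Polynomial.C_mul]; ring
  rw [e]
  exact (Splits.X_sub_C r).mul (Splits.X_add_C r)

/-- `X ^ n - a` and `X ^ n - b` are coprime for `a ≠ b`. [folklore] -/
theorem isCoprime_X_pow_sub_C {K : Type*} [Field K] {a b : K} (h : a ≠ b) (n : ℕ) :
    IsCoprime (X ^ n - C a) (X ^ n - C b) := by
  refine ⟨C (b - a)⁻¹, -C (b - a)⁻¹, ?_⟩
  rw [neg_mul, ← sub_eq_add_neg, ← mul_sub, sub_sub_sub_cancel_left, ← Polynomial.C_sub,
    ← Polynomial.C_mul, inv_mul_cancel₀ (sub_ne_zero.mpr h.symm), Polynomial.C_1]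

/-- `(X² + 1)(X² - 41)(X² - 73)` is separable. [folklore] -/
theorem F4.poly_separable : F4.poly.Separable := by
  have hs : ∀ a : ℚ, a ≠ 0 → (X ^ 2 - C a : ℚ[X]).Separable := fun a ha =>
    separable_X_pow_sub_C a (by norm_num) ha
  refine ((hs (-1) (by norm_num)).mul (hs 41 (by norm_num)) ?_).mul (hs 73 (by norm_num)) ?_
  · exact isCoprime_X_pow_sub_C (by norm_num) 2
  · exact (isCoprime_X_pow_sub_C (by norm_num) 2).mul_left (isCoprime_X_pow_sub_C (by norm_num) 2)

/-- `(√-1)² = -1` in `F4`. [folklore] -/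
@[simp] theorem F4.rtm1_sq : F4.rtm1 ^ 2 = -1 := by rw [sq, F4.rtm1_mul_self]
/-- `(√41)² = 41` in `F4`. [folklore] -/
@[simp] theorem F4.rt41_sq : F4.rt41 ^ 2 = 41 := by rw [sq, F4.rt41_mul_self]
/-- `(√73)² = 73` in `F4`. [folklore] -/
@[simp] theorem F4.rt73_sq : F4.rt73 ^ 2 = 73 := by rw [sq, F4.rt73_mul_self]

/-- `F4` is generated by `√-1, √41, √73` over `ℚ`. [folklore] -/
theorem F4.adjoin_eq_top : Algebra.adjoin ℚ {F4.rtm1, F4.rt41, F4.rt73} = ⊤ := by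
  rw [eq_top_iff]
  intro z _
  set S := Algebra.adjoin ℚ ({F4.rtm1, F4.rt41, F4.rt73} : Set F4)
  have ha : F4.rtm1 ∈ S := Algebra.subset_adjoin (by simp)
  have hb : F4.rt41 ∈ S := Algebra.subset_adjoin (by simp)
  have hc : F4.rt73 ∈ S := Algebra.subset_adjoin (by simp)
  have hq : ∀ q : ℚ, (q : F4) ∈ S := fun q => by
    have h := S.algebraMap_mem q
    rwa [eq_ratCast] at h
  have h1 : ∀ t : K1, algebraMap K1 F4 t ∈ S := fun t => by
    rw [F4.algebraMap_K1]
    exact add_mem (hq _) (mul_mem (hq _) ha)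
  have h2 : ∀ u : K2, algebraMap K2 F4 u ∈ S := fun u => by
    rw [F4.algebraMap_K2]
    exact add_mem (h1 _) (mul_mem (h1 _) hb)
  rw [F4.self_eq z]
  exact add_mem (h2 _) (mul_mem (h2 _) hc)

/-- The image of `F4.poly` in `F4[X]`. [folklore] -/
theorem F4.poly_map :
    F4.poly.map (algebraMap ℚ F4) = (X ^ 2 - C (-1)) * (X ^ 2 - C 41) * (X ^ 2 - C 73) := by
  simp only [F4.poly, Polynomial.map_mul, Polynomial.map_sub, Polynomial.map_pow, map_X, map_C,
    eq_ratCast, Rat.cast_neg, Rat.cast_one, Rat.cast_ofNat]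

/-- `F4.poly` splits in `F4`. [folklore] -/
theorem F4.poly_splits : Splits (F4.poly.map (algebraMap ℚ F4)) := by
  rw [F4.poly_map]
  exact ((splits_X_sq_sub_C F4.rtm1_mul_self).mul (splits_X_sq_sub_C F4.rt41_mul_self)).mul
    (splits_X_sq_sub_C F4.rt73_mul_self)

/-- `aeval x F4.poly` in closed form. [folklore] -/
theorem F4.aeval_poly (x : F4) :
    aeval x F4.poly = (x ^ 2 - (-1)) * (x ^ 2 - 41) * (x ^ 2 - 73) := by
  simp only [F4.poly, map_mul, map_sub, aeval_X_pow, aeval_C, eq_ratCast, Rat.cast_neg,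
    Rat.cast_one, Rat.cast_ofNat]

/-- `√-1, √41, √73` are roots of `F4.poly`. [folklore] -/
theorem F4.mem_rootSet : {F4.rtm1, F4.rt41, F4.rt73} ⊆ F4.poly.rootSet F4 := by
  have hne : F4.poly ≠ 0 := F4.poly_separable.ne_zero
  intro x hx
  rw [mem_rootSet_of_ne hne, F4.aeval_poly]
  simp only [Set.mem_insert_iff, Set.mem_singleton_iff] at hx
  rcases hx with rfl | rfl | rfl
  · rw [F4.rtm1_sq, sub_self, zero_mul, zero_mul]
  · rw [F4.rt41_sq, sub_self, mul_zero, zero_mul]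
  · rw [F4.rt73_sq, sub_self, mul_zero]

/-- `F4` is a splitting field of `(X² + 1)(X² - 41)(X² - 73)` over `ℚ`. [folklore] -/
instance F4.isSplittingField : F4.poly.IsSplittingField ℚ F4 where
  splits' := F4.poly_splits
  adjoin_rootSet' := by
    rw [eq_top_iff, ← F4.adjoin_eq_top]
    exact Algebra.adjoin_mono F4.mem_rootSet

/-- `F4 = ℚ(√-1, √41, √73)` is Galois over `ℚ`. [folklore] -/
instance F4.isGalois : IsGalois ℚ F4 :=
  IsGalois.of_separable_splitting_field F4.poly_separable

/-- `|Gal(F4/ℚ)| = 8`. [folklore] -/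
theorem F4.card_algEquiv : Nat.card (F4 ≃ₐ[ℚ] F4) = 8 := by
  rw [IsGalois.card_aut_eq_finrank, F4.finrank_eq]

end DokchitserDokchitser2011

end Literature.Barriers.BirchSwinnertonDyer

end
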